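import Mathlib.Algebra.Order.Floor.Ring
import Literature.ComputerArithmetic.ConnollyHighamMary2021.StochasticRounding
import HarnessLib

/-!
# El Arar–Fasi–Filip–Mikaitis 2025: limited-precision stochastic rounding `SR_{p,r}`

HONEST FRAMING: certified error envelopes and provably optimal rounding/accumulation schemes for
low-precision formats under stated cost models; every table by two implementations; no hardware
or vendor claims.

Source. E.-M. El Arar, M. Fasi, S.-I. Filip, M. Mikaitis, *Probabilistic error analysis of
limited-precision stochastic rounding*, SIAM J. Sci. Comput. 47(5) (2025), doi:10.1137/24m1681458
= arXiv:2408.03069 [cite: ElararEtAl2025]. Page/section pointers below are to the arXiv version.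

What is typed here (verbatim, measure-free, over an arbitrary finite value set `F ⊂ K` with the
candidates `⌊x⌋ = roundDown F x`, `⌈x⌉ = roundUp F x`, `ε = ⌈x⌉ − ⌊x⌋` and the exact-SR probability
`q(x) = (x − ⌊x⌋)/ε` of [ConnollyHighamMary2021] (`probUp`); the precision-`(p+r)` truncation
`tr_{p+r}` is an arbitrary map `tr : K → K` — every identity below holds for any `tr`):
* §2.3 Def. 4: `SR_{p,r}(x) = ⌈x⌉` with probability `q_r(x) = (tr_{p+r}(x) − ⌊x⌋)/ε`, else `⌊x⌋`
  (`limProb`, `limMean`);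
* §3, first display: `E(SR_{p,r}(x)) = tr_{p+r}(x)`, hence the bias `E(SR_{p,r}(x) − x) =
  tr_{p+r}(x) − x` and `E(δ) = β` (`limMean_eq`, `limMean_sub_eq`) — PROVED (algebra);
* §3, variance display: `V(SR_{p,r}(x)) = ε² q_r(x)(1 − q_r(x))`, and `≤ ε²/4` (the paper's
  `≤ x²u_p²/4` after `ε ≤ |x|u_p`), "interestingly, [it] does not depend on the number of random
  bits `r`" (`limVar_eq`, `limVar_le`) — PROVED;
* the truncation written on the gap, `tr(x) = ⌊x⌋ + ε·⌊q(x)2^r⌋/2^r` (Fig. 1 of the source: the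
  `p+r`-bit grid subdivides `[⌊x⌋, ⌈x⌉]` into `2^r` parts; for a binary precision-`p` format in the
  normal range this IS `tr_{p+r}` — that identification is not proved here), gives
  `q_r(x) = ⌊q(x)2^r⌋/2^r` (`limProb_truncGap`): the IEEE P3109 `StochasticA` rule with `N = r` bits
  (`Literature.ComputerArithmetic.P3109.StochasticA`; venture files `LowPrec/SRLimitedBits*`, where
  `probAwayA r η = ⌊η2^r⌋/2^r` and the per-step / n-step bias, the minimax comparison with the
  half-bit rules B/C and the stagnation thresholds are proved).
NOT typed here: Lemma 3 (`E(δ_k | δ_1,…,δ_{k−1}) = β_k` — its content is the per-step identity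
`limMean_eq` applied conditionally), Theorem 1 (`E ∏(1+δ_k) ≤ (1+u_{p+r})^n`), Lemmas 4–5 and
Theorems 2–7 (martingale / Azuma bounds for inner products, matrix–vector products, Horner), §6
(experiments): these are statements in the probabilistic relative-error model; the exact
finite-format counterparts for P3109 A/B/C are the venture files `SRLimitedBits`,
`SRHoeffdingLimitedBits`, `SRLimitedBitsOptimal`.
-/

namespace Literature.ComputerArithmetic.ElararEtAl2025

open Literature.ComputerArithmetic.ConnollyHighamMary2021

variable {K : Type*} [Field K] [LinearOrder K] [IsStrictOrderedRing K]

/-- `q_r(x) = (tr_{p+r}(x) − ⌊x⌋_p)/(⌈x⌉_p − ⌊x⌋_p)`: the probability of rounding up under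
limited-precision SR, for a truncation operator `tr` (field convention `a/0 = 0` when `x ∈ F`).
[cite: ElararEtAl2025, §2.3 Def. 4] -/
def limProb (F : Finset K) (tr : K → K) (x : K) : K :=
  (tr x - roundDown F x) / (roundUp F x - roundDown F x)

/-- `E(SR_{p,r}(x)) = q_r(x)⌈x⌉_p + (1 − q_r(x))⌊x⌋_p`, the mean of the two-point law of Def. 4.
[cite: ElararEtAl2025, §3 (first display)] -/
def limMean (F : Finset K) (tr : K → K) (x : K) : K :=
  limProb F tr x * roundUp F x + (1 - limProb F tr x) * roundDown F x

/-- Second central moment of the two-point law of Def. 4 (about its mean `E(SR_{p,r}(x))`).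
[cite: ElararEtAl2025, §3 (variance display)] -/
def limVar (F : Finset K) (tr : K → K) (x : K) : K :=
  limProb F tr x * (roundUp F x - limMean F tr x) ^ 2
    + (1 - limProb F tr x) * (roundDown F x - limMean F tr x) ^ 2

omit [IsStrictOrderedRing K] in
/-- **`E(SR_{p,r}(x)) = tr_{p+r}(x)`** ("Unlike `SR_p`, the limited-precision `SR_{p,r}` operator is
biased, since `E(SR_{p,r}(x)) = q_r(x)(⌈x⌉_p − ⌊x⌋_p) + ⌊x⌋_p = tr_{p+r}(x)`"), for `x ∉ F`
(candidates distinct). [cite: ElararEtAl2025, §3 (first display)] -/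
theorem limMean_eq (F : Finset K) (tr : K → K) {x : K} (h : roundUp F x ≠ roundDown F x) :
    limMean F tr x = tr x := by
  unfold limMean limProb
  have hne : roundUp F x - roundDown F x ≠ 0 := sub_ne_zero.mpr h
  field_simp
  ring

omit [IsStrictOrderedRing K] in
/-- **Bias** "Consequently, the bias `E(SR_{p,r}(x) − x)` is given by `tr_{p+r}(x) − x`" (and
`E(δ) = β` for the relative errors `SR_{p,r}(x) = x(1+δ)`, `tr_{p+r}(x) = x(1+β)`).
[cite: ElararEtAl2025, §3 (3.1)] -/
theorem limMean_sub_eq (F : Finset K) (tr : K → K) {x : K} (h : roundUp F x ≠ roundDown F x) :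
    limMean F tr x - x = tr x - x := by
  rw [limMean_eq F tr h]

omit [IsStrictOrderedRing K] in
/-- A member of `F` is not rounded: `E(SR_{p,r}(x)) = x` ("If `x ∈ F`, `δ = 0`").
[cite: ElararEtAl2025, §3] -/
theorem limMean_eq_self_of_mem (F : Finset K) (tr : K → K) {x : K} (hx : x ∈ F) :
    limMean F tr x = x := by
  unfold limMean limProb
  rw [roundDown_eq_self_of_mem hx, roundUp_eq_self_of_mem hx, sub_self, div_zero]
  ring

omit [IsStrictOrderedRing K] in
/-- **Variance identity** `V(SR_{p,r}(x)) = ε² q_r(x)(1 − q_r(x))` with `ε = ⌈x⌉_p − ⌊x⌋_p`.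
[cite: ElararEtAl2025, §3 (variance display)] -/
theorem limVar_eq (F : Finset K) (tr : K → K) (x : K) :
    limVar F tr x
      = (roundUp F x - roundDown F x) ^ 2 * (limProb F tr x * (1 - limProb F tr x)) := by
  unfold limVar limMean
  ring

/-- **Variance bound** `V(SR_{p,r}(x)) ≤ ε²/4` (as `q(1 − q) ≤ 1/4` for every `q`); with
`ε ≤ |x|u_p` this is the paper's `V(SR_{p,r}(x)) ≤ x²u_p²/4`, which "does not depend on the number
of random bits `r` used". [cite: ElararEtAl2025, §3 (3.2)] -/
theorem limVar_le (F : Finset K) (tr : K → K) (x : K) :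
    limVar F tr x ≤ (roundUp F x - roundDown F x) ^ 2 / 4 := by
  rw [limVar_eq]
  have hq : limProb F tr x * (1 - limProb F tr x) ≤ 1 / 4 := by
    nlinarith [sq_nonneg (limProb F tr x - 1 / 2)]
  have hε : 0 ≤ (roundUp F x - roundDown F x) ^ 2 := sq_nonneg _
  calc (roundUp F x - roundDown F x) ^ 2 * (limProb F tr x * (1 - limProb F tr x))
      ≤ (roundUp F x - roundDown F x) ^ 2 * (1 / 4) := mul_le_mul_of_nonneg_left hq hε
    _ = (roundUp F x - roundDown F x) ^ 2 / 4 := by ring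

/-! ### The truncation written on the gap: `q_r` is the `r`-bit truncation of `q` -/

/-- The precision-`(p+r)` truncation of `x` written on the gap of its precision-`p` candidates:
`⌊x⌋_p + ε·⌊q(x)2^r⌋/2^r` (the `2^r` grid points of `[⌊x⌋_p, ⌈x⌉_p]`, Fig. 1 of the source; for a
binary format in the normal range this is `tr_{p+r}(x)` — not proved here).
[cite: ElararEtAl2025, §2.3 Def. 4 and Fig. 1] -/
def truncGap [FloorRing K] (F : Finset K) (r : ℕ) (x : K) : K :=
  roundDown F x + (roundUp F x - roundDown F x) * ((⌊probUp F x * 2 ^ r⌋ : K) / 2 ^ r)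

omit [IsStrictOrderedRing K] in
/-- With the gap truncation, **`q_r(x) = ⌊q(x)2^r⌋/2^r`**: limited-precision SR with `r` random bits
is exact SR with its probability truncated to `r` bits — the IEEE P3109 `StochasticA` rule
(`Literature.ComputerArithmetic.P3109.StochasticA`; `probAwayA` of the venture files), for `x ∉ F`.
[cite: ElararEtAl2025, §2.3 Def. 4] -/
theorem limProb_truncGap [FloorRing K] (F : Finset K) (r : ℕ) {x : K}
    (h : roundUp F x ≠ roundDown F x) :
    limProb F (truncGap F r) x = (⌊probUp F x * 2 ^ r⌋ : K) / 2 ^ r := by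
  unfold limProb truncGap
  have hne : roundUp F x - roundDown F x ≠ 0 := sub_ne_zero.mpr h
  field_simp
  ring

/-- ... hence `E(SR_{p,r}(x)) = ⌊x⌋_p + ε⌊q(x)2^r⌋/2^r ≤ x`: the bias of the truncation-based rule
points down (towards `⌊x⌋_p`), by at most `ε2^{-r}` ("for a large number of random bits `r`,
`tr_{p+r}(x)` tends to `x`", Remark 3). [cite: ElararEtAl2025, §3 Remark 3] -/
theorem limMean_truncGap_le [FloorRing K] (F : Finset K) (r : ℕ) {x : K}
    (h : roundUp F x ≠ roundDown F x) :
    limMean F (truncGap F r) x ≤ x ∧ x - limMean F (truncGap F r) x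
      ≤ (roundUp F x - roundDown F x) / 2 ^ r := by
  rw [limMean_eq F _ h]
  unfold truncGap
  have hε : 0 < roundUp F x - roundDown F x :=
    lt_of_le_of_ne (sub_nonneg.mpr (roundDown_le_roundUp F x)) (Ne.symm (sub_ne_zero.mpr h))
  have h2 : (0 : K) < 2 ^ r := by positivity
  have hq : probUp F x = (x - roundDown F x) / (roundUp F x - roundDown F x) := rfl
  have hfl : ((⌊probUp F x * 2 ^ r⌋ : ℤ) : K) ≤ probUp F x * 2 ^ r := Int.floor_le _
  have hfl' : probUp F x * 2 ^ r < ((⌊probUp F x * 2 ^ r⌋ : ℤ) : K) + 1 := Int.lt_floor_add_one _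
  have hx : x = roundDown F x + (roundUp F x - roundDown F x) * probUp F x := by
    rw [hq]; field_simp; ring
  constructor
  · have : (roundUp F x - roundDown F x) * (((⌊probUp F x * 2 ^ r⌋ : ℤ) : K) / 2 ^ r)
        ≤ (roundUp F x - roundDown F x) * probUp F x :=
      mul_le_mul_of_nonneg_left (by rw [div_le_iff₀ h2]; exact hfl) hε.le
    linarith
  · have : (roundUp F x - roundDown F x) * probUp F x
        - (roundUp F x - roundDown F x) * (((⌊probUp F x * 2 ^ r⌋ : ℤ) : K) / 2 ^ r)
        ≤ (roundUp F x - roundDown F x) / 2 ^ r := by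
      rw [← mul_sub, div_eq_mul_one_div (roundUp F x - roundDown F x)]
      refine mul_le_mul_of_nonneg_left ?_ hε.le
      rw [sub_le_iff_le_add, ← add_div, le_div_iff₀ h2]
      linarith
    linarith

end Literature.ComputerArithmetic.ElararEtAl2025
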